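import Summits.AnomalousDissipation.AnomalousDissipation.Theorems.MomentParityQuarticGateAxialQuadCentreBase

/-!
# Axial quadratic rigidity (stub S2q of line `axis-sectors`, crux `MomentParity.QuarticGate`):
# the centre sector — peeling induction on `|k|²`

**Centre rigidity.** Under `(POL)`, symmetry and transversality, EVERY wavevector of the punctured
ball `0 < |k|² ≤ N²` (`N ≥ 2`) is pinned to one pair `(α, β)`: the centre blocks are
`A_k = α + β k×` on `k⊥` — energy and helicity. Induction on `|k|²`: the base `|k|² ≤ 3` is
`pinned_of_normSq_le_three`; a vector with two nonzero coordinates peels as `(k - e) + e` along a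
signed coordinate vector `e` (unequal step: `|k - e|² = |e|²` would force `|k|² = 2|kᵢ|`, impossible
for `|k|² ≥ 4` unless `k` is an axis vector); an axis vector `a eᵢ` peels as
`((a - s) eᵢ + s eⱼ) + (s eᵢ - s eⱼ)` for `|a| ≥ 3` and by two equal pairs for `|a| = 2`
(`pin_axis₀,₁,₂`).
-/

namespace Summit.AnomalousDissipation.AnomalousDissipation.Theorems.MomentParityQuarticGate.AxialQuad

open Matrix

-- `Summit.<Summit>.<Problem>` is the tree's mandated summit-side namespace (CONVENTIONS §2); for this
-- single-conjunct summit the two coincide, so the duplicate is deliberate.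
set_option linter.dupNamespace false

variable (Q : (Fin 3 → ℤ) → (Fin 3 → ℤ) → Matrix (Fin 3) (Fin 3) ℂ) {N : ℕ}

/-- **Axis vectors, first axis.** If every shorter vector of the punctured ball is pinned, an axis
vector `k = (a, 0, 0)` with `a² ≥ 4` is pinned: for `|a| ≥ 3` by the unequal step
`(a - s, s, 0) + (s, -s, 0)` (`s = sign a`), for `|a| = 2` by the two equal pairs
`(s, ±1, 0)`, `(s, 0, ±1)` whose polarisations `e₂`, `e₁` are independent. [folklore] -/
theorem pin_axis₀ (hsymm : ∀ a b, Q b a = (Q a b)ᵀ) (hrow : ∀ a b, (fun i : Fin 3 => (((a : Fin 3 → ℤ) i : ℤ) : ℂ)) ᵥ* Q a b = 0)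
    (hcol : ∀ a b, Q a b *ᵥ (fun i : Fin 3 => (((b : Fin 3 → ℤ) i : ℤ) : ℂ)) = 0) (hpol : (∀ (k₁ k₂ k₃ : Fin 3 → ℤ) (v₁ v₂ v₃ : Fin 3 → ℂ), ((k₁ : Fin 3 → ℤ) ≠ 0 ∧ (k₁) ⬝ᵥ (k₁) ≤ ((N : ℕ) : ℤ) ^ 2) → ((k₂ : Fin 3 → ℤ) ≠ 0 ∧ (k₂) ⬝ᵥ (k₂) ≤ ((N : ℕ) : ℤ) ^ 2) → ((k₃ : Fin 3 → ℤ) ≠ 0 ∧ (k₃) ⬝ᵥ (k₃) ≤ ((N : ℕ) : ℤ) ^ 2) → v₁ ⬝ᵥ (fun i : Fin 3 => (((k₁ : Fin 3 → ℤ) i : ℤ) : ℂ)) = 0 → v₂ ⬝ᵥ (fun i : Fin 3 => (((k₂ : Fin 3 → ℤ) i : ℤ) : ℂ)) = 0 → v₃ ⬝ᵥ (fun i : Fin 3 => (((k₃ : Fin 3 → ℤ) i : ℤ) : ℂ)) = 0 → (((v₁) ⬝ᵥ (fun i : Fin 3 => (((k₂ : Fin 3 → ℤ) i : ℤ) : ℂ)))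 • (v₂) + ((v₂) ⬝ᵥ (fun i : Fin 3 => (((k₁ : Fin 3 → ℤ) i : ℤ) : ℂ))) • (v₁) : Fin 3 → ℂ) ⬝ᵥ (Q (k₁ + k₂) k₃ *ᵥ v₃) + (((v₁) ⬝ᵥ (fun i : Fin 3 => (((k₃ : Fin 3 → ℤ) i : ℤ) : ℂ))) • (v₃) + ((v₃) ⬝ᵥ (fun i : Fin 3 => (((k₁ : Fin 3 → ℤ) i : ℤ) : ℂ))) • (v₁) : Fin 3 → ℂ) ⬝ᵥ (Q (k₁ + k₃) k₂ *ᵥ v₂) + (((v₂) ⬝ᵥ (fun i : Fin 3 => (((k₃ : Fin 3 → ℤ) i : ℤ) : ℂ))) • (v₃) + ((v₃) ⬝ᵥ (fun i : Fin 3 => (((k₂ : Fin 3 → ℤ) i : ℤ) : ℂ))) • (v₂) : Fin 3 → ℂ) ⬝ᵥ (Q (k₂ + k₃) k₁ *ᵥ v₁) = 0)) {α β : ℂ} (a : ℤ)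
    (hk : ((![a, 0, 0] : Fin 3 → ℤ) ≠ 0 ∧ (![a, 0, 0]) ⬝ᵥ (![a, 0, 0]) ≤ ((N : ℕ) : ℤ) ^ 2)) (h4 : 4 ≤ a * a)
    (ih : ∀ k' : Fin 3 → ℤ, ((k' : Fin 3 → ℤ) ≠ 0 ∧ (k') ⬝ᵥ (k') ≤ ((N : ℕ) : ℤ) ^ 2) → k' ⬝ᵥ k' < a * a → (∀ y : Fin 3 → ℂ, y ⬝ᵥ (fun i : Fin 3 => (((k' : Fin 3 → ℤ) i : ℤ) : ℂ)) = 0 → Q (-(k')) (k') *ᵥ y = (α) • y + (β) • ((fun i : Fin 3 => (((k' : Fin 3 → ℤ) i : ℤ) : ℂ)) ⨯₃ y))) :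
    (∀ y : Fin 3 → ℂ, y ⬝ᵥ (fun i : Fin 3 => (((![a, 0, 0] : Fin 3 → ℤ) i : ℤ) : ℂ)) = 0 → Q (-(![a, 0, 0])) (![a, 0, 0]) *ᵥ y = (α) • y + (β) • ((fun i : Fin 3 => (((![a, 0, 0] : Fin 3 → ℤ) i : ℤ) : ℂ)) ⨯₃ y)) := by
  have hN : a * a ≤ ((N : ℕ) : ℤ) ^ 2 := by simpa [vec3_dotProduct] using hk.2
  -- the sign of `a`
  obtain ⟨s, rfl | rfl, has⟩ : ∃ s : ℤ, (s = 1 ∨ s = -1) ∧ 2 ≤ a * s := by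
    rcases le_or_gt 0 a with h | h
    · exact ⟨1, Or.inl rfl, by nlinarith⟩
    · exact ⟨-1, Or.inr rfl, by nlinarith⟩
  · -- `a ≥ 2`
    by_cases ha : a = 2
    · subst ha
      have e : (![1, 1, 0] + ![1, -1, 0] : Fin 3 → ℤ) = ![2, 0, 0] := by decide
      have hb : ∀ l : Fin 3 → ℤ, l ≠ 0 → l ⬝ᵥ l = 2 → ((l : Fin 3 → ℤ) ≠ 0 ∧ (l) ⬝ᵥ (l) ≤ ((N : ℕ) : ℤ) ^ 2) ∧ l ⬝ᵥ l < 2 * 2 := fun l h1 h2 =>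
        ⟨⟨h1, by rw [h2]; linarith⟩, by rw [h2]; norm_num⟩
      obtain ⟨b₁, c₁⟩ := hb ![1, 1, 0] (by decide) (by rw [vec3_dotProduct]; decide)
      obtain ⟨b₂, c₂⟩ := hb ![1, -1, 0] (by decide) (by rw [vec3_dotProduct]; decide)
      obtain ⟨b₃, c₃⟩ := hb ![1, 0, 1] (by decide) (by rw [vec3_dotProduct]; decide)
      obtain ⟨b₄, c₄⟩ := hb ![1, 0, -1] (by decide) (by rw [vec3_dotProduct]; decide)
      have h := pin_sum_two_pairs Q hsymm hrow hcol hpol (k₁ := ![1, 1, 0]) (k₂ := ![1, -1, 0])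
        (l₁ := ![1, 0, 1]) (l₂ := ![1, 0, -1]) b₁ b₂ b₃ b₄ (by rw [e]; exact hk) (by decide)
        (by rw [cross_apply]; decide) (by rw [cross_apply]; decide)
        (by rw [cross_apply, cross_apply, e, Matrix.det_fin_three]; decide)
        (ih _ b₁ c₁) (ih _ b₂ c₂) (ih _ b₃ c₃) (ih _ b₄ c₄)
      rwa [e] at h
    · have ha3 : 3 ≤ a := by omega
      have e : (![a - 1, 1, 0] + ![1, -1, 0] : Fin 3 → ℤ) = ![a, 0, 0] := by
        ext i; fin_cases i <;> simp
      have n₁ : ![a - 1, 1, 0] ⬝ᵥ ![a - 1, 1, 0] = a * a - 2 * a + 2 := by rw [vec3_dotProduct]; simp; ring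
      have n₂ : (![1, -1, 0] : Fin 3 → ℤ) ⬝ᵥ ![1, -1, 0] = 2 := by rw [vec3_dotProduct]; simp
      have b₁ : ((![a - 1, 1, 0] : Fin 3 → ℤ) ≠ 0 ∧ (![a - 1, 1, 0]) ⬝ᵥ (![a - 1, 1, 0]) ≤ ((N : ℕ) : ℤ) ^ 2) := ⟨fun h => by simpa using congrFun h 1, by rw [n₁]; nlinarith⟩
      have b₂ : ((![1, -1, 0] : Fin 3 → ℤ) ≠ 0 ∧ (![1, -1, 0]) ⬝ᵥ (![1, -1, 0]) ≤ ((N : ℕ) : ℤ) ^ 2) := ⟨by decide, by rw [n₂]; nlinarith⟩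
      have h := pin_sum_unequal Q hsymm hrow hcol hpol (k₁ := ![a - 1, 1, 0]) (k₂ := ![1, -1, 0]) b₁ b₂
        (by rw [e]; exact hk) (fun h => by have := congrFun h 2; simp [cross_apply] at this; omega)
        (by rw [n₁, n₂]; nlinarith) (ih _ b₁ (by rw [n₁]; nlinarith)) (ih _ b₂ (by rw [n₂]; nlinarith))
      rwa [e] at h
  · -- `a ≤ -2`
    by_cases ha : a = -2
    · subst ha
      have e : (![-1, 1, 0] + ![-1, -1, 0] : Fin 3 → ℤ) = ![-2, 0, 0] := by decide
      have hb : ∀ l : Fin 3 → ℤ, l ≠ 0 → l ⬝ᵥ l = 2 → ((l : Fin 3 → ℤ) ≠ 0 ∧ (l) ⬝ᵥ (l) ≤ ((N : ℕ) : ℤ) ^ 2) ∧ l ⬝ᵥ l < -2 * -2 := fun l h1 h2 =>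
        ⟨⟨h1, by rw [h2]; linarith⟩, by rw [h2]; norm_num⟩
      obtain ⟨b₁, c₁⟩ := hb ![-1, 1, 0] (by decide) (by rw [vec3_dotProduct]; decide)
      obtain ⟨b₂, c₂⟩ := hb ![-1, -1, 0] (by decide) (by rw [vec3_dotProduct]; decide)
      obtain ⟨b₃, c₃⟩ := hb ![-1, 0, 1] (by decide) (by rw [vec3_dotProduct]; decide)
      obtain ⟨b₄, c₄⟩ := hb ![-1, 0, -1] (by decide) (by rw [vec3_dotProduct]; decide)
      have h := pin_sum_two_pairs Q hsymm hrow hcol hpol (k₁ := ![-1, 1, 0]) (k₂ := ![-1, -1, 0])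
        (l₁ := ![-1, 0, 1]) (l₂ := ![-1, 0, -1]) b₁ b₂ b₃ b₄ (by rw [e]; exact hk) (by decide)
        (by rw [cross_apply]; decide) (by rw [cross_apply]; decide)
        (by rw [cross_apply, cross_apply, e, Matrix.det_fin_three]; decide)
        (ih _ b₁ c₁) (ih _ b₂ c₂) (ih _ b₃ c₃) (ih _ b₄ c₄)
      rwa [e] at h
    · have ha3 : a ≤ -3 := by omega
      have e : (![a + 1, -1, 0] + ![-1, 1, 0] : Fin 3 → ℤ) = ![a, 0, 0] := by
        ext i; fin_cases i <;> simp
      have n₁ : ![a + 1, -1, 0] ⬝ᵥ ![a + 1, -1, 0] = a * a + 2 * a + 2 := by rw [vec3_dotProduct]; simp; ring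
      have n₂ : (![-1, 1, 0] : Fin 3 → ℤ) ⬝ᵥ ![-1, 1, 0] = 2 := by rw [vec3_dotProduct]; simp
      have b₁ : ((![a + 1, -1, 0] : Fin 3 → ℤ) ≠ 0 ∧ (![a + 1, -1, 0]) ⬝ᵥ (![a + 1, -1, 0]) ≤ ((N : ℕ) : ℤ) ^ 2) := ⟨fun h => by simpa using congrFun h 1, by rw [n₁]; nlinarith⟩
      have b₂ : ((![-1, 1, 0] : Fin 3 → ℤ) ≠ 0 ∧ (![-1, 1, 0]) ⬝ᵥ (![-1, 1, 0]) ≤ ((N : ℕ) : ℤ) ^ 2) := ⟨by decide, by rw [n₂]; nlinarith⟩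
      have h := pin_sum_unequal Q hsymm hrow hcol hpol (k₁ := ![a + 1, -1, 0]) (k₂ := ![-1, 1, 0]) b₁ b₂
        (by rw [e]; exact hk) (fun h => by have := congrFun h 2; simp [cross_apply] at this; omega)
        (by rw [n₁, n₂]; nlinarith) (ih _ b₁ (by rw [n₁]; nlinarith)) (ih _ b₂ (by rw [n₂]; nlinarith))
      rwa [e] at h

/-- **Axis vectors, second axis.** If every shorter vector of the punctured ball is pinned, an axis
vector `k = (0, a, 0)` with `a² ≥ 4` is pinned: for `|a| ≥ 3` by the unequal step
`(0, a - s, s) + (0, s, -s)` (`s = sign a`), for `|a| = 2` by the two equal pairs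
`(0, s, ±1)`, `(±1, s, 0)` whose polarisations `e₀`, `e₂` are independent. [folklore] -/
theorem pin_axis₁ (hsymm : ∀ a b, Q b a = (Q a b)ᵀ) (hrow : ∀ a b, (fun i : Fin 3 => (((a : Fin 3 → ℤ) i : ℤ) : ℂ)) ᵥ* Q a b = 0)
    (hcol : ∀ a b, Q a b *ᵥ (fun i : Fin 3 => (((b : Fin 3 → ℤ) i : ℤ) : ℂ)) = 0) (hpol : (∀ (k₁ k₂ k₃ : Fin 3 → ℤ) (v₁ v₂ v₃ : Fin 3 → ℂ), ((k₁ : Fin 3 → ℤ) ≠ 0 ∧ (k₁) ⬝ᵥ (k₁) ≤ ((N : ℕ) : ℤ) ^ 2) → ((k₂ : Fin 3 → ℤ) ≠ 0 ∧ (k₂) ⬝ᵥ (k₂) ≤ ((N : ℕ) : ℤ) ^ 2) → ((k₃ : Fin 3 → ℤ) ≠ 0 ∧ (k₃) ⬝ᵥ (k₃) ≤ ((N : ℕ) : ℤ) ^ 2) → v₁ ⬝ᵥ (fun i : Fin 3 => (((k₁ : Fin 3 → ℤ) i : ℤ) : ℂ)) = 0 → v₂ ⬝ᵥ (fun i : Fin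 3 => (((k₂ : Fin 3 → ℤ) i : ℤ) : ℂ)) = 0 → v₃ ⬝ᵥ (fun i : Fin 3 => (((k₃ : Fin 3 → ℤ) i : ℤ) : ℂ)) = 0 → (((v₁) ⬝ᵥ (fun i : Fin 3 => (((k₂ : Fin 3 → ℤ) i : ℤ) : ℂ))) • (v₂) + ((v₂) ⬝ᵥ (fun i : Fin 3 => (((k₁ : Fin 3 → ℤ) i : ℤ) : ℂ))) • (v₁) : Fin 3 → ℂ) ⬝ᵥ (Q (k₁ + k₂) k₃ *ᵥ v₃) + (((v₁) ⬝ᵥ (fun i : Fin 3 => (((k₃ : Fin 3 → ℤ) i : ℤ) : ℂ))) • (v₃) + ((v₃) ⬝ᵥ (fun i : Fin 3 => (((k₁ : Fin 3 → ℤ) i : ℤ) : ℂ))) • (v₁) : Fin 3 → ℂ) ⬝ᵥ (Q (k₁ + k₃) k₂ *ᵥ v₂) + (((v₂) ⬝ᵥ (fun i : Fin 3 => (((k₃ : Fin 3 → ℤ) i : ℤ) : ℂ))) • (v₃) + ((v₃) ⬝ᵥ (fun i : Fin 3 => (((k₂ : Fin 3 → ℤ) i : ℤ) : ℂ))) • (v₂)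 : Fin 3 → ℂ) ⬝ᵥ (Q (k₂ + k₃) k₁ *ᵥ v₁) = 0)) {α β : ℂ} (a : ℤ)
    (hk : ((![0, a, 0] : Fin 3 → ℤ) ≠ 0 ∧ (![0, a, 0]) ⬝ᵥ (![0, a, 0]) ≤ ((N : ℕ) : ℤ) ^ 2)) (h4 : 4 ≤ a * a)
    (ih : ∀ k' : Fin 3 → ℤ, ((k' : Fin 3 → ℤ) ≠ 0 ∧ (k') ⬝ᵥ (k') ≤ ((N : ℕ) : ℤ) ^ 2) → k' ⬝ᵥ k' < a * a → (∀ y : Fin 3 → ℂ, y ⬝ᵥ (fun i : Fin 3 => (((k' : Fin 3 → ℤ) i : ℤ) : ℂ)) = 0 → Q (-(k')) (k') *ᵥ y = (α) • y + (β) • ((fun i : Fin 3 => (((k' : Fin 3 → ℤ) i : ℤ) : ℂ)) ⨯₃ y))) :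
    (∀ y : Fin 3 → ℂ, y ⬝ᵥ (fun i : Fin 3 => (((![0, a, 0] : Fin 3 → ℤ) i : ℤ) : ℂ)) = 0 → Q (-(![0, a, 0])) (![0, a, 0]) *ᵥ y = (α) • y + (β) • ((fun i : Fin 3 => (((![0, a, 0] : Fin 3 → ℤ) i : ℤ) : ℂ)) ⨯₃ y)) := by
  have hN : a * a ≤ ((N : ℕ) : ℤ) ^ 2 := by simpa [vec3_dotProduct] using hk.2
  -- the sign of `a`
  obtain ⟨s, rfl | rfl, has⟩ : ∃ s : ℤ, (s = 1 ∨ s = -1) ∧ 2 ≤ a * s := by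
    rcases le_or_gt 0 a with h | h
    · exact ⟨1, Or.inl rfl, by nlinarith⟩
    · exact ⟨-1, Or.inr rfl, by nlinarith⟩
  · -- `a ≥ 2`
    by_cases ha : a = 2
    · subst ha
      have e : (![0, 1, 1] + ![0, 1, -1] : Fin 3 → ℤ) = ![0, 2, 0] := by decide
      have hb : ∀ l : Fin 3 → ℤ, l ≠ 0 → l ⬝ᵥ l = 2 → ((l : Fin 3 → ℤ) ≠ 0 ∧ (l) ⬝ᵥ (l) ≤ ((N : ℕ) : ℤ) ^ 2) ∧ l ⬝ᵥ l < 2 * 2 := fun l h1 h2 =>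
        ⟨⟨h1, by rw [h2]; linarith⟩, by rw [h2]; norm_num⟩
      obtain ⟨b₁, c₁⟩ := hb ![0, 1, 1] (by decide) (by rw [vec3_dotProduct]; decide)
      obtain ⟨b₂, c₂⟩ := hb ![0, 1, -1] (by decide) (by rw [vec3_dotProduct]; decide)
      obtain ⟨b₃, c₃⟩ := hb ![1, 1, 0] (by decide) (by rw [vec3_dotProduct]; decide)
      obtain ⟨b₄, c₄⟩ := hb ![-1, 1, 0] (by decide) (by rw [vec3_dotProduct]; decide)
      have h := pin_sum_two_pairs Q hsymm hrow hcol hpol (k₁ := ![0, 1, 1]) (k₂ := ![0, 1, -1])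
        (l₁ := ![1, 1, 0]) (l₂ := ![-1, 1, 0]) b₁ b₂ b₃ b₄ (by rw [e]; exact hk) (by decide)
        (by rw [cross_apply]; decide) (by rw [cross_apply]; decide)
        (by rw [cross_apply, cross_apply, e, Matrix.det_fin_three]; decide)
        (ih _ b₁ c₁) (ih _ b₂ c₂) (ih _ b₃ c₃) (ih _ b₄ c₄)
      rwa [e] at h
    · have ha3 : 3 ≤ a := by omega
      have e : (![0, a - 1, 1] + ![0, 1, -1] : Fin 3 → ℤ) = ![0, a, 0] := by
        ext i; fin_cases i <;> simp
      have n₁ : ![0, a - 1, 1] ⬝ᵥ ![0, a - 1, 1] = a * a - 2 * a + 2 := by rw [vec3_dotProduct]; simp; ring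
      have n₂ : (![0, 1, -1] : Fin 3 → ℤ) ⬝ᵥ ![0, 1, -1] = 2 := by rw [vec3_dotProduct]; simp
      have b₁ : ((![0, a - 1, 1] : Fin 3 → ℤ) ≠ 0 ∧ (![0, a - 1, 1]) ⬝ᵥ (![0, a - 1, 1]) ≤ ((N : ℕ) : ℤ) ^ 2) := ⟨fun h => by simpa using congrFun h 2, by rw [n₁]; nlinarith⟩
      have b₂ : ((![0, 1, -1] : Fin 3 → ℤ) ≠ 0 ∧ (![0, 1, -1]) ⬝ᵥ (![0, 1, -1]) ≤ ((N : ℕ) : ℤ) ^ 2) := ⟨by decide, by rw [n₂]; nlinarith⟩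
      have h := pin_sum_unequal Q hsymm hrow hcol hpol (k₁ := ![0, a - 1, 1]) (k₂ := ![0, 1, -1]) b₁ b₂
        (by rw [e]; exact hk) (fun h => by have := congrFun h 0; simp [cross_apply] at this; omega)
        (by rw [n₁, n₂]; nlinarith) (ih _ b₁ (by rw [n₁]; nlinarith)) (ih _ b₂ (by rw [n₂]; nlinarith))
      rwa [e] at h
  · -- `a ≤ -2`
    by_cases ha : a = -2
    · subst ha
      have e : (![0, -1, 1] + ![0, -1, -1] : Fin 3 → ℤ) = ![0, -2, 0] := by decide
      have hb : ∀ l : Fin 3 → ℤ, l ≠ 0 → l ⬝ᵥ l = 2 → ((l : Fin 3 → ℤ) ≠ 0 ∧ (l) ⬝ᵥ (l) ≤ ((N : ℕ) : ℤ) ^ 2) ∧ l ⬝ᵥ l < -2 * -2 := fun l h1 h2 =>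
        ⟨⟨h1, by rw [h2]; linarith⟩, by rw [h2]; norm_num⟩
      obtain ⟨b₁, c₁⟩ := hb ![0, -1, 1] (by decide) (by rw [vec3_dotProduct]; decide)
      obtain ⟨b₂, c₂⟩ := hb ![0, -1, -1] (by decide) (by rw [vec3_dotProduct]; decide)
      obtain ⟨b₃, c₃⟩ := hb ![1, -1, 0] (by decide) (by rw [vec3_dotProduct]; decide)
      obtain ⟨b₄, c₄⟩ := hb ![-1, -1, 0] (by decide) (by rw [vec3_dotProduct]; decide)
      have h := pin_sum_two_pairs Q hsymm hrow hcol hpol (k₁ := ![0, -1, 1]) (k₂ := ![0, -1, -1])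
        (l₁ := ![1, -1, 0]) (l₂ := ![-1, -1, 0]) b₁ b₂ b₃ b₄ (by rw [e]; exact hk) (by decide)
        (by rw [cross_apply]; decide) (by rw [cross_apply]; decide)
        (by rw [cross_apply, cross_apply, e, Matrix.det_fin_three]; decide)
        (ih _ b₁ c₁) (ih _ b₂ c₂) (ih _ b₃ c₃) (ih _ b₄ c₄)
      rwa [e] at h
    · have ha3 : a ≤ -3 := by omega
      have e : (![0, a + 1, -1] + ![0, -1, 1] : Fin 3 → ℤ) = ![0, a, 0] := by
        ext i; fin_cases i <;> simp
      have n₁ : ![0, a + 1, -1] ⬝ᵥ ![0, a + 1, -1] = a * a + 2 * a + 2 := by rw [vec3_dotProduct]; simp; ring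
      have n₂ : (![0, -1, 1] : Fin 3 → ℤ) ⬝ᵥ ![0, -1, 1] = 2 := by rw [vec3_dotProduct]; simp
      have b₁ : ((![0, a + 1, -1] : Fin 3 → ℤ) ≠ 0 ∧ (![0, a + 1, -1]) ⬝ᵥ (![0, a + 1, -1]) ≤ ((N : ℕ) : ℤ) ^ 2) := ⟨fun h => by simpa using congrFun h 2, by rw [n₁]; nlinarith⟩
      have b₂ : ((![0, -1, 1] : Fin 3 → ℤ) ≠ 0 ∧ (![0, -1, 1]) ⬝ᵥ (![0, -1, 1]) ≤ ((N : ℕ) : ℤ) ^ 2) := ⟨by decide, by rw [n₂]; nlinarith⟩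
      have h := pin_sum_unequal Q hsymm hrow hcol hpol (k₁ := ![0, a + 1, -1]) (k₂ := ![0, -1, 1]) b₁ b₂
        (by rw [e]; exact hk) (fun h => by have := congrFun h 0; simp [cross_apply] at this; omega)
        (by rw [n₁, n₂]; nlinarith) (ih _ b₁ (by rw [n₁]; nlinarith)) (ih _ b₂ (by rw [n₂]; nlinarith))
      rwa [e] at h

/-- **Axis vectors, third axis.** If every shorter vector of the punctured ball is pinned, an axis
vector `k = (0, 0, a)` with `a² ≥ 4` is pinned: for `|a| ≥ 3` by the unequal step
`(s, 0, a - s) + (-s, 0, s)` (`s = sign a`), for `|a| = 2` by the two equal pairs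
`(±1, 0, s)`, `(0, ±1, s)` whose polarisations `e₁`, `e₀` are independent. [folklore] -/
theorem pin_axis₂ (hsymm : ∀ a b, Q b a = (Q a b)ᵀ) (hrow : ∀ a b, (fun i : Fin 3 => (((a : Fin 3 → ℤ) i : ℤ) : ℂ)) ᵥ* Q a b = 0)
    (hcol : ∀ a b, Q a b *ᵥ (fun i : Fin 3 => (((b : Fin 3 → ℤ) i : ℤ) : ℂ)) = 0) (hpol : (∀ (k₁ k₂ k₃ : Fin 3 → ℤ) (v₁ v₂ v₃ : Fin 3 → ℂ), ((k₁ : Fin 3 → ℤ) ≠ 0 ∧ (k₁) ⬝ᵥ (k₁) ≤ ((N : ℕ) : ℤ) ^ 2) → ((k₂ : Fin 3 → ℤ) ≠ 0 ∧ (k₂) ⬝ᵥ (k₂) ≤ ((N : ℕ) : ℤ) ^ 2) → ((k₃ : Fin 3 → ℤ) ≠ 0 ∧ (k₃) ⬝ᵥ (k₃) ≤ ((N : ℕ) : ℤ) ^ 2) → v₁ ⬝ᵥ (fun i : Fin 3 => (((k₁ : Fin 3 → ℤ) i : ℤ) : ℂ)) = 0 → v₂ ⬝ᵥ (fun i : Fin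 3 => (((k₂ : Fin 3 → ℤ) i : ℤ) : ℂ)) = 0 → v₃ ⬝ᵥ (fun i : Fin 3 => (((k₃ : Fin 3 → ℤ) i : ℤ) : ℂ)) = 0 → (((v₁) ⬝ᵥ (fun i : Fin 3 => (((k₂ : Fin 3 → ℤ) i : ℤ) : ℂ))) • (v₂) + ((v₂) ⬝ᵥ (fun i : Fin 3 => (((k₁ : Fin 3 → ℤ) i : ℤ) : ℂ))) • (v₁) : Fin 3 → ℂ) ⬝ᵥ (Q (k₁ + k₂) k₃ *ᵥ v₃) + (((v₁) ⬝ᵥ (fun i : Fin 3 => (((k₃ : Fin 3 → ℤ) i : ℤ) : ℂ))) • (v₃) + ((v₃) ⬝ᵥ (fun i : Fin 3 => (((k₁ : Fin 3 → ℤ) i : ℤ) : ℂ))) • (v₁) : Fin 3 → ℂ) ⬝ᵥ (Q (k₁ + k₃) k₂ *ᵥ v₂) + (((v₂) ⬝ᵥ (fun i : Fin 3 => (((k₃ : Fin 3 → ℤ) i : ℤ) : ℂ))) • (v₃) + ((v₃) ⬝ᵥ (fun i : Fin 3 => (((k₂ : Fin 3 → ℤ) i : ℤ) : ℂ))) • (v₂)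 : Fin 3 → ℂ) ⬝ᵥ (Q (k₂ + k₃) k₁ *ᵥ v₁) = 0)) {α β : ℂ} (a : ℤ)
    (hk : ((![0, 0, a] : Fin 3 → ℤ) ≠ 0 ∧ (![0, 0, a]) ⬝ᵥ (![0, 0, a]) ≤ ((N : ℕ) : ℤ) ^ 2)) (h4 : 4 ≤ a * a)
    (ih : ∀ k' : Fin 3 → ℤ, ((k' : Fin 3 → ℤ) ≠ 0 ∧ (k') ⬝ᵥ (k') ≤ ((N : ℕ) : ℤ) ^ 2) → k' ⬝ᵥ k' < a * a → (∀ y : Fin 3 → ℂ, y ⬝ᵥ (fun i : Fin 3 => (((k' : Fin 3 → ℤ) i : ℤ) : ℂ)) = 0 → Q (-(k')) (k') *ᵥ y = (α) • y + (β) • ((fun i : Fin 3 => (((k' : Fin 3 → ℤ) i : ℤ) : ℂ)) ⨯₃ y))) :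
    (∀ y : Fin 3 → ℂ, y ⬝ᵥ (fun i : Fin 3 => (((![0, 0, a] : Fin 3 → ℤ) i : ℤ) : ℂ)) = 0 → Q (-(![0, 0, a])) (![0, 0, a]) *ᵥ y = (α) • y + (β) • ((fun i : Fin 3 => (((![0, 0, a] : Fin 3 → ℤ) i : ℤ) : ℂ)) ⨯₃ y)) := by
  have hN : a * a ≤ ((N : ℕ) : ℤ) ^ 2 := by simpa [vec3_dotProduct] using hk.2
  -- the sign of `a`
  obtain ⟨s, rfl | rfl, has⟩ : ∃ s : ℤ, (s = 1 ∨ s = -1) ∧ 2 ≤ a * s := by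
    rcases le_or_gt 0 a with h | h
    · exact ⟨1, Or.inl rfl, by nlinarith⟩
    · exact ⟨-1, Or.inr rfl, by nlinarith⟩
  · -- `a ≥ 2`
    by_cases ha : a = 2
    · subst ha
      have e : (![1, 0, 1] + ![-1, 0, 1] : Fin 3 → ℤ) = ![0, 0, 2] := by decide
      have hb : ∀ l : Fin 3 → ℤ, l ≠ 0 → l ⬝ᵥ l = 2 → ((l : Fin 3 → ℤ) ≠ 0 ∧ (l) ⬝ᵥ (l) ≤ ((N : ℕ) : ℤ) ^ 2) ∧ l ⬝ᵥ l < 2 * 2 := fun l h1 h2 =>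
        ⟨⟨h1, by rw [h2]; linarith⟩, by rw [h2]; norm_num⟩
      obtain ⟨b₁, c₁⟩ := hb ![1, 0, 1] (by decide) (by rw [vec3_dotProduct]; decide)
      obtain ⟨b₂, c₂⟩ := hb ![-1, 0, 1] (by decide) (by rw [vec3_dotProduct]; decide)
      obtain ⟨b₃, c₃⟩ := hb ![0, 1, 1] (by decide) (by rw [vec3_dotProduct]; decide)
      obtain ⟨b₄, c₄⟩ := hb ![0, -1, 1] (by decide) (by rw [vec3_dotProduct]; decide)
      have h := pin_sum_two_pairs Q hsymm hrow hcol hpol (k₁ := ![1, 0, 1]) (k₂ := ![-1, 0, 1])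
        (l₁ := ![0, 1, 1]) (l₂ := ![0, -1, 1]) b₁ b₂ b₃ b₄ (by rw [e]; exact hk) (by decide)
        (by rw [cross_apply]; decide) (by rw [cross_apply]; decide)
        (by rw [cross_apply, cross_apply, e, Matrix.det_fin_three]; decide)
        (ih _ b₁ c₁) (ih _ b₂ c₂) (ih _ b₃ c₃) (ih _ b₄ c₄)
      rwa [e] at h
    · have ha3 : 3 ≤ a := by omega
      have e : (![1, 0, a - 1] + ![-1, 0, 1] : Fin 3 → ℤ) = ![0, 0, a] := by
        ext i; fin_cases i <;> simp
      have n₁ : ![1, 0, a - 1] ⬝ᵥ ![1, 0, a - 1] = a * a - 2 * a + 2 := by rw [vec3_dotProduct]; simp; ring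
      have n₂ : (![-1, 0, 1] : Fin 3 → ℤ) ⬝ᵥ ![-1, 0, 1] = 2 := by rw [vec3_dotProduct]; simp
      have b₁ : ((![1, 0, a - 1] : Fin 3 → ℤ) ≠ 0 ∧ (![1, 0, a - 1]) ⬝ᵥ (![1, 0, a - 1]) ≤ ((N : ℕ) : ℤ) ^ 2) := ⟨fun h => by simpa using congrFun h 0, by rw [n₁]; nlinarith⟩
      have b₂ : ((![-1, 0, 1] : Fin 3 → ℤ) ≠ 0 ∧ (![-1, 0, 1]) ⬝ᵥ (![-1, 0, 1]) ≤ ((N : ℕ) : ℤ) ^ 2) := ⟨by decide, by rw [n₂]; nlinarith⟩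
      have h := pin_sum_unequal Q hsymm hrow hcol hpol (k₁ := ![1, 0, a - 1]) (k₂ := ![-1, 0, 1]) b₁ b₂
        (by rw [e]; exact hk) (fun h => by have := congrFun h 1; simp [cross_apply] at this; omega)
        (by rw [n₁, n₂]; nlinarith) (ih _ b₁ (by rw [n₁]; nlinarith)) (ih _ b₂ (by rw [n₂]; nlinarith))
      rwa [e] at h
  · -- `a ≤ -2`
    by_cases ha : a = -2
    · subst ha
      have e : (![1, 0, -1] + ![-1, 0, -1] : Fin 3 → ℤ) = ![0, 0, -2] := by decide
      have hb : ∀ l : Fin 3 → ℤ, l ≠ 0 → l ⬝ᵥ l = 2 → ((l : Fin 3 → ℤ) ≠ 0 ∧ (l) ⬝ᵥ (l) ≤ ((N : ℕ) : ℤ) ^ 2) ∧ l ⬝ᵥ l < -2 * -2 := fun l h1 h2 =>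
        ⟨⟨h1, by rw [h2]; linarith⟩, by rw [h2]; norm_num⟩
      obtain ⟨b₁, c₁⟩ := hb ![1, 0, -1] (by decide) (by rw [vec3_dotProduct]; decide)
      obtain ⟨b₂, c₂⟩ := hb ![-1, 0, -1] (by decide) (by rw [vec3_dotProduct]; decide)
      obtain ⟨b₃, c₃⟩ := hb ![0, 1, -1] (by decide) (by rw [vec3_dotProduct]; decide)
      obtain ⟨b₄, c₄⟩ := hb ![0, -1, -1] (by decide) (by rw [vec3_dotProduct]; decide)
      have h := pin_sum_two_pairs Q hsymm hrow hcol hpol (k₁ := ![1, 0, -1]) (k₂ := ![-1, 0, -1])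
        (l₁ := ![0, 1, -1]) (l₂ := ![0, -1, -1]) b₁ b₂ b₃ b₄ (by rw [e]; exact hk) (by decide)
        (by rw [cross_apply]; decide) (by rw [cross_apply]; decide)
        (by rw [cross_apply, cross_apply, e, Matrix.det_fin_three]; decide)
        (ih _ b₁ c₁) (ih _ b₂ c₂) (ih _ b₃ c₃) (ih _ b₄ c₄)
      rwa [e] at h
    · have ha3 : a ≤ -3 := by omega
      have e : (![-1, 0, a + 1] + ![1, 0, -1] : Fin 3 → ℤ) = ![0, 0, a] := by
        ext i; fin_cases i <;> simp
      have n₁ : ![-1, 0, a + 1] ⬝ᵥ ![-1, 0, a + 1] = a * a + 2 * a + 2 := by rw [vec3_dotProduct]; simp; ring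
      have n₂ : (![1, 0, -1] : Fin 3 → ℤ) ⬝ᵥ ![1, 0, -1] = 2 := by rw [vec3_dotProduct]; simp
      have b₁ : ((![-1, 0, a + 1] : Fin 3 → ℤ) ≠ 0 ∧ (![-1, 0, a + 1]) ⬝ᵥ (![-1, 0, a + 1]) ≤ ((N : ℕ) : ℤ) ^ 2) := ⟨fun h => by simpa using congrFun h 0, by rw [n₁]; nlinarith⟩
      have b₂ : ((![1, 0, -1] : Fin 3 → ℤ) ≠ 0 ∧ (![1, 0, -1]) ⬝ᵥ (![1, 0, -1]) ≤ ((N : ℕ) : ℤ) ^ 2) := ⟨by decide, by rw [n₂]; nlinarith⟩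
      have h := pin_sum_unequal Q hsymm hrow hcol hpol (k₁ := ![-1, 0, a + 1]) (k₂ := ![1, 0, -1]) b₁ b₂
        (by rw [e]; exact hk) (fun h => by have := congrFun h 1; simp [cross_apply] at this; omega)
        (by rw [n₁, n₂]; nlinarith) (ih _ b₁ (by rw [n₁]; nlinarith)) (ih _ b₂ (by rw [n₂]; nlinarith))
      rwa [e] at h

/-- Arithmetic of the coordinate peel: `x² + y² + z² = 2|x| ≥ 4` forces `y = z = 0`. [folklore] -/
theorem normSq_ne_two_mul (x y z t : ℤ) (h4 : 4 ≤ x * x + y * y + z * z) (hyz : y ≠ 0 ∨ z ≠ 0)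
    (ht : 0 < t) (htt : t * t = x * x) : x * x + y * y + z * z ≠ 2 * t := by
  intro h
  have ht2 : t = 2 := by nlinarith [mul_self_nonneg y, mul_self_nonneg z]
  subst ht2
  have hy2 : y * y = 0 := by nlinarith [mul_self_nonneg y, mul_self_nonneg z]
  have hz2 : z * z = 0 := by nlinarith [mul_self_nonneg y, mul_self_nonneg z]
  rcases hyz with h' | h'
  · exact h' (mul_self_eq_zero.1 hy2)
  · exact h' (mul_self_eq_zero.1 hz2)

/-- **Coordinate peel along the first axis**: `k₀ ≠ 0` and another nonzero coordinate. [folklore] -/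
theorem pin_peel₀ (hsymm : ∀ a b, Q b a = (Q a b)ᵀ) (hrow : ∀ a b, (fun i : Fin 3 => (((a : Fin 3 → ℤ) i : ℤ) : ℂ)) ᵥ* Q a b = 0)
    (hcol : ∀ a b, Q a b *ᵥ (fun i : Fin 3 => (((b : Fin 3 → ℤ) i : ℤ) : ℂ)) = 0) (hpol : (∀ (k₁ k₂ k₃ : Fin 3 → ℤ) (v₁ v₂ v₃ : Fin 3 → ℂ), ((k₁ : Fin 3 → ℤ) ≠ 0 ∧ (k₁) ⬝ᵥ (k₁) ≤ ((N : ℕ) : ℤ) ^ 2) → ((k₂ : Fin 3 → ℤ) ≠ 0 ∧ (k₂) ⬝ᵥ (k₂) ≤ ((N : ℕ) : ℤ) ^ 2) → ((k₃ : Fin 3 → ℤ) ≠ 0 ∧ (k₃) ⬝ᵥ (k₃) ≤ ((N : ℕ) : ℤ) ^ 2) → v₁ ⬝ᵥ (fun i : Fin 3 => (((k₁ : Fin 3 → ℤ) i : ℤ) : ℂ)) = 0 → v₂ ⬝ᵥ (fun i : Fin 3 => (((k₂ : Fin 3 → ℤ) i : ℤ) : ℂ)) = 0 → v₃ ⬝ᵥ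 (fun i : Fin 3 => (((k₃ : Fin 3 → ℤ) i : ℤ) : ℂ)) = 0 → (((v₁) ⬝ᵥ (fun i : Fin 3 => (((k₂ : Fin 3 → ℤ) i : ℤ) : ℂ))) • (v₂) + ((v₂) ⬝ᵥ (fun i : Fin 3 => (((k₁ : Fin 3 → ℤ) i : ℤ) : ℂ))) • (v₁) : Fin 3 → ℂ) ⬝ᵥ (Q (k₁ + k₂) k₃ *ᵥ v₃) + (((v₁) ⬝ᵥ (fun i : Fin 3 => (((k₃ : Fin 3 → ℤ) i : ℤ) : ℂ))) • (v₃) + ((v₃) ⬝ᵥ (fun i : Fin 3 => (((k₁ : Fin 3 → ℤ) i : ℤ) : ℂ))) • (v₁) : Fin 3 → ℂ) ⬝ᵥ (Q (k₁ + k₃) k₂ *ᵥ v₂) + (((v₂) ⬝ᵥ (fun i : Fin 3 => (((k₃ : Fin 3 → ℤ) i : ℤ) : ℂ))) • (v₃) + ((v₃) ⬝ᵥ (fun i : Fin 3 => (((k₂ : Fin 3 → ℤ) i : ℤ) : ℂ))) • (v₂) : Fin 3 → ℂ) ⬝ᵥ (Q (k₂ + k₃) k₁ *ᵥ v₁) =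 0)) {α β : ℂ} {k : Fin 3 → ℤ}
    (hk : ((k : Fin 3 → ℤ) ≠ 0 ∧ (k) ⬝ᵥ (k) ≤ ((N : ℕ) : ℤ) ^ 2)) (hk0 : k 0 ≠ 0) (h12 : k 1 ≠ 0 ∨ k 2 ≠ 0) (h4 : 4 ≤ k ⬝ᵥ k)
    (ih : ∀ k' : Fin 3 → ℤ, ((k' : Fin 3 → ℤ) ≠ 0 ∧ (k') ⬝ᵥ (k') ≤ ((N : ℕ) : ℤ) ^ 2) → k' ⬝ᵥ k' < k ⬝ᵥ k → (∀ y : Fin 3 → ℂ, y ⬝ᵥ (fun i : Fin 3 => (((k' : Fin 3 → ℤ) i : ℤ) : ℂ)) = 0 → Q (-(k')) (k') *ᵥ y = (α) • y + (β) • ((fun i : Fin 3 => (((k' : Fin 3 → ℤ) i : ℤ) : ℂ)) ⨯₃ y))) :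
    (∀ y : Fin 3 → ℂ, y ⬝ᵥ (fun i : Fin 3 => (((k : Fin 3 → ℤ) i : ℤ) : ℂ)) = 0 → Q (-(k)) (k) *ᵥ y = (α) • y + (β) • ((fun i : Fin 3 => (((k : Fin 3 → ℤ) i : ℤ) : ℂ)) ⨯₃ y)) := by
  have h4' : 4 ≤ k 0 * k 0 + k 1 * k 1 + k 2 * k 2 := by rwa [vec3_dotProduct] at h4
  rcases lt_or_gt_of_ne hk0 with hneg | hpos
  · refine pin_of_peel Q hsymm hrow hcol hpol (e := ![-1, 0, 0]) hk (by rw [vec3_dotProduct]; decide)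
      (by rw [vec3_dotProduct]; simp; linarith) (fun h => ?_) ?_ ih
    · rcases h12 with h' | h'
      · exact h' (by simpa [cross_apply] using congrFun h 2)
      · exact h' (by simpa [cross_apply] using congrFun h 1)
    · have := normSq_ne_two_mul (k 0) (k 1) (k 2) (-k 0) h4' h12 (by linarith) (by ring)
      rw [vec3_dotProduct, vec3_dotProduct]; simpa using this
  · refine pin_of_peel Q hsymm hrow hcol hpol (e := ![1, 0, 0]) hk (by rw [vec3_dotProduct]; decide)
      (by rw [vec3_dotProduct]; simp; linarith) (fun h => ?_) ?_ ih
    · rcases h12 with h' | h'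
      · exact h' (by simpa [cross_apply] using congrFun h 2)
      · exact h' (by simpa [cross_apply] using congrFun h 1)
    · have := normSq_ne_two_mul (k 0) (k 1) (k 2) (k 0) h4' h12 (by linarith) (by ring)
      rw [vec3_dotProduct, vec3_dotProduct]; simpa using this

/-- **Coordinate peel along the second axis**: `k₁ ≠ 0` and `k₂ ≠ 0`. [folklore] -/
theorem pin_peel₁ (hsymm : ∀ a b, Q b a = (Q a b)ᵀ) (hrow : ∀ a b, (fun i : Fin 3 => (((a : Fin 3 → ℤ) i : ℤ) : ℂ)) ᵥ* Q a b = 0)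
    (hcol : ∀ a b, Q a b *ᵥ (fun i : Fin 3 => (((b : Fin 3 → ℤ) i : ℤ) : ℂ)) = 0) (hpol : (∀ (k₁ k₂ k₃ : Fin 3 → ℤ) (v₁ v₂ v₃ : Fin 3 → ℂ), ((k₁ : Fin 3 → ℤ) ≠ 0 ∧ (k₁) ⬝ᵥ (k₁) ≤ ((N : ℕ) : ℤ) ^ 2) → ((k₂ : Fin 3 → ℤ) ≠ 0 ∧ (k₂) ⬝ᵥ (k₂) ≤ ((N : ℕ) : ℤ) ^ 2) → ((k₃ : Fin 3 → ℤ) ≠ 0 ∧ (k₃) ⬝ᵥ (k₃) ≤ ((N : ℕ) : ℤ) ^ 2) → v₁ ⬝ᵥ (fun i : Fin 3 => (((k₁ : Fin 3 → ℤ) i : ℤ) : ℂ)) = 0 → v₂ ⬝ᵥ (fun i : Fin 3 => (((k₂ : Fin 3 → ℤ) i : ℤ) : ℂ)) = 0 → v₃ ⬝ᵥ (fun i : Fin 3 => (((k₃ : Fin 3 → ℤ) i : ℤ) : ℂ)) = 0 → (((v₁) ⬝ᵥ (fun i : Fin 3 => (((k₂ : Fin 3 → ℤ) i : ℤ) : ℂ)))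 • (v₂) + ((v₂) ⬝ᵥ (fun i : Fin 3 => (((k₁ : Fin 3 → ℤ) i : ℤ) : ℂ))) • (v₁) : Fin 3 → ℂ) ⬝ᵥ (Q (k₁ + k₂) k₃ *ᵥ v₃) + (((v₁) ⬝ᵥ (fun i : Fin 3 => (((k₃ : Fin 3 → ℤ) i : ℤ) : ℂ))) • (v₃) + ((v₃) ⬝ᵥ (fun i : Fin 3 => (((k₁ : Fin 3 → ℤ) i : ℤ) : ℂ))) • (v₁) : Fin 3 → ℂ) ⬝ᵥ (Q (k₁ + k₃) k₂ *ᵥ v₂) + (((v₂) ⬝ᵥ (fun i : Fin 3 => (((k₃ : Fin 3 → ℤ) i : ℤ) : ℂ))) • (v₃) + ((v₃) ⬝ᵥ (fun i : Fin 3 => (((k₂ : Fin 3 → ℤ) i : ℤ) : ℂ))) • (v₂) : Fin 3 → ℂ) ⬝ᵥ (Q (k₂ + k₃) k₁ *ᵥ v₁) = 0)) {α β : ℂ} {k : Fin 3 → ℤ}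
    (hk : ((k : Fin 3 → ℤ) ≠ 0 ∧ (k) ⬝ᵥ (k) ≤ ((N : ℕ) : ℤ) ^ 2)) (hk1 : k 1 ≠ 0) (hk2 : k 2 ≠ 0) (h4 : 4 ≤ k ⬝ᵥ k)
    (ih : ∀ k' : Fin 3 → ℤ, ((k' : Fin 3 → ℤ) ≠ 0 ∧ (k') ⬝ᵥ (k') ≤ ((N : ℕ) : ℤ) ^ 2) → k' ⬝ᵥ k' < k ⬝ᵥ k → (∀ y : Fin 3 → ℂ, y ⬝ᵥ (fun i : Fin 3 => (((k' : Fin 3 → ℤ) i : ℤ) : ℂ)) = 0 → Q (-(k')) (k') *ᵥ y = (α) • y + (β) • ((fun i : Fin 3 => (((k' : Fin 3 → ℤ) i : ℤ) : ℂ)) ⨯₃ y))) :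
    (∀ y : Fin 3 → ℂ, y ⬝ᵥ (fun i : Fin 3 => (((k : Fin 3 → ℤ) i : ℤ) : ℂ)) = 0 → Q (-(k)) (k) *ᵥ y = (α) • y + (β) • ((fun i : Fin 3 => (((k : Fin 3 → ℤ) i : ℤ) : ℂ)) ⨯₃ y)) := by
  have h4' : 4 ≤ k 1 * k 1 + k 2 * k 2 + k 0 * k 0 := by rw [vec3_dotProduct] at h4; linarith
  rcases lt_or_gt_of_ne hk1 with hneg | hpos
  · refine pin_of_peel Q hsymm hrow hcol hpol (e := ![0, -1, 0]) hk (by rw [vec3_dotProduct]; decide)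
      (by rw [vec3_dotProduct]; simp; linarith) (fun h => hk2 (by simpa [cross_apply] using congrFun h 0))
      ?_ ih
    have := normSq_ne_two_mul (k 1) (k 2) (k 0) (-k 1) h4' (Or.inl hk2) (by linarith) (by ring)
    rw [vec3_dotProduct, vec3_dotProduct]; simp; intro h; exact this (by linarith)
  · refine pin_of_peel Q hsymm hrow hcol hpol (e := ![0, 1, 0]) hk (by rw [vec3_dotProduct]; decide)
      (by rw [vec3_dotProduct]; simp; linarith) (fun h => hk2 (by simpa [cross_apply] using congrFun h 0))
      ?_ ih
    have := normSq_ne_two_mul (k 1) (k 2) (k 0) (k 1) h4' (Or.inl hk2) (by linarith) (by ring)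
    rw [vec3_dotProduct, vec3_dotProduct]; simp; intro h; exact this (by linarith)

/-- **CENTRE RIGIDITY.** At level `N ≥ 2`, under `(POL)`, symmetry and transversality of the
blocks, every wavevector of the punctured ball is pinned to `(α, β) = ((A_{e₀})₁₁, (A_{e₀})₂₁)`:
the centre blocks of a quadratic Casimir of ball-truncated Euler are a combination of energy and
helicity. [folklore] -/
theorem centre_pinned (hN : 2 ≤ N) (hsymm : ∀ a b, Q b a = (Q a b)ᵀ)
    (hrow : ∀ a b, (fun i : Fin 3 => (((a : Fin 3 → ℤ) i : ℤ) : ℂ)) ᵥ* Q a b = 0) (hcol : ∀ a b, Q a b *ᵥ (fun i : Fin 3 => (((b : Fin 3 → ℤ) i : ℤ) : ℂ)) = 0) (hpol : (∀ (k₁ k₂ k₃ : Fin 3 → ℤ) (v₁ v₂ v₃ : Fin 3 → ℂ), ((k₁ : Fin 3 → ℤ) ≠ 0 ∧ (k₁) ⬝ᵥ (k₁) ≤ ((N : ℕ) : ℤ) ^ 2) → ((k₂ : Fin 3 → ℤ) ≠ 0 ∧ (k₂) ⬝ᵥ (k₂) ≤ ((N : ℕ) : ℤ) ^ 2) → ((k₃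 : Fin 3 → ℤ) ≠ 0 ∧ (k₃) ⬝ᵥ (k₃) ≤ ((N : ℕ) : ℤ) ^ 2) → v₁ ⬝ᵥ (fun i : Fin 3 => (((k₁ : Fin 3 → ℤ) i : ℤ) : ℂ)) = 0 → v₂ ⬝ᵥ (fun i : Fin 3 => (((k₂ : Fin 3 → ℤ) i : ℤ) : ℂ)) = 0 → v₃ ⬝ᵥ (fun i : Fin 3 => (((k₃ : Fin 3 → ℤ) i : ℤ) : ℂ)) = 0 → (((v₁) ⬝ᵥ (fun i : Fin 3 => (((k₂ : Fin 3 → ℤ) i : ℤ) : ℂ))) • (v₂) + ((v₂) ⬝ᵥ (fun i : Fin 3 => (((k₁ : Fin 3 → ℤ) i : ℤ) : ℂ))) • (v₁) : Fin 3 → ℂ) ⬝ᵥ (Q (k₁ + k₂) k₃ *ᵥ v₃) + (((v₁) ⬝ᵥ (fun i : Fin 3 => (((k₃ : Fin 3 → ℤ) i : ℤ) : ℂ))) • (v₃) + ((v₃) ⬝ᵥ (fun i : Fin 3 => (((k₁ : Fin 3 → ℤ) i : ℤ) : ℂ))) • (v₁) : Fin 3 → ℂ) ⬝ᵥ (Q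 (k₁ + k₃) k₂ *ᵥ v₂) + (((v₂) ⬝ᵥ (fun i : Fin 3 => (((k₃ : Fin 3 → ℤ) i : ℤ) : ℂ))) • (v₃) + ((v₃) ⬝ᵥ (fun i : Fin 3 => (((k₂ : Fin 3 → ℤ) i : ℤ) : ℂ))) • (v₂) : Fin 3 → ℂ) ⬝ᵥ (Q (k₂ + k₃) k₁ *ᵥ v₁) = 0))
    (k : Fin 3 → ℤ) (hk : ((k : Fin 3 → ℤ) ≠ 0 ∧ (k) ⬝ᵥ (k) ≤ ((N : ℕ) : ℤ) ^ 2)) :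
    (∀ y : Fin 3 → ℂ, y ⬝ᵥ (fun i : Fin 3 => (((k : Fin 3 → ℤ) i : ℤ) : ℂ)) = 0 → Q (-(k)) (k) *ᵥ y = (Q ![-1, 0, 0] ![1, 0, 0] 1 1) • y + (Q ![-1, 0, 0] ![1, 0, 0] 2 1) • ((fun i : Fin 3 => (((k : Fin 3 → ℤ) i : ℤ) : ℂ)) ⨯₃ y)) := by
  suffices H : ∀ n : ℕ, ∀ k : Fin 3 → ℤ, ((k : Fin 3 → ℤ) ≠ 0 ∧ (k) ⬝ᵥ (k) ≤ ((N : ℕ) : ℤ) ^ 2) → k ⬝ᵥ k ≤ n →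
      (∀ y : Fin 3 → ℂ, y ⬝ᵥ (fun i : Fin 3 => (((k : Fin 3 → ℤ) i : ℤ) : ℂ)) = 0 → Q (-(k)) (k) *ᵥ y = (Q ![-1, 0, 0] ![1, 0, 0] 1 1) • y + (Q ![-1, 0, 0] ![1, 0, 0] 2 1) • ((fun i : Fin 3 => (((k : Fin 3 → ℤ) i : ℤ) : ℂ)) ⨯₃ y)) from
    H _ k hk (Int.self_le_toNat _)
  intro n
  induction n using Nat.strong_induction_on with
  | _ n ih =>
  intro k hk hkn
  by_cases h3 : k ⬝ᵥ k ≤ 3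
  · exact pinned_of_normSq_le_three Q hN hsymm hrow hcol hpol k hk h3
  have h4 : 4 ≤ k ⬝ᵥ k := by omega
  have ih' : ∀ k' : Fin 3 → ℤ, ((k' : Fin 3 → ℤ) ≠ 0 ∧ (k') ⬝ᵥ (k') ≤ ((N : ℕ) : ℤ) ^ 2) → k' ⬝ᵥ k' < k ⬝ᵥ k →
      (∀ y : Fin 3 → ℂ, y ⬝ᵥ (fun i : Fin 3 => (((k' : Fin 3 → ℤ) i : ℤ) : ℂ)) = 0 → Q (-(k')) (k') *ᵥ y = (Q ![-1, 0, 0] ![1, 0, 0] 1 1) • y + (Q ![-1, 0, 0] ![1, 0, 0] 2 1) • ((fun i : Fin 3 => (((k' : Fin 3 → ℤ) i : ℤ) : ℂ)) ⨯₃ y)) :=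
    fun k' hk' hlt => ih (n - 1) (by omega) k' hk' (by omega)
  by_cases h0 : k 0 = 0
  · by_cases h1 : k 1 = 0
    · by_cases h2 : k 2 = 0
      · exact absurd (funext fun i => by fin_cases i <;> assumption) hk.1
      · obtain ⟨a, rfl⟩ : ∃ a, k = ![0, 0, a] := ⟨k 2, by ext i; fin_cases i <;> simp [h0, h1]⟩
        exact pin_axis₂ Q hsymm hrow hcol hpol a hk (by simpa [vec3_dotProduct] using h4)
          fun k' hk' hlt => ih' k' hk' (by simpa [vec3_dotProduct] using hlt)
    · by_cases h2 : k 2 = 0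
      · obtain ⟨a, rfl⟩ : ∃ a, k = ![0, a, 0] := ⟨k 1, by ext i; fin_cases i <;> simp [h0, h2]⟩
        exact pin_axis₁ Q hsymm hrow hcol hpol a hk (by simpa [vec3_dotProduct] using h4)
          fun k' hk' hlt => ih' k' hk' (by simpa [vec3_dotProduct] using hlt)
      · exact pin_peel₁ Q hsymm hrow hcol hpol hk h1 h2 h4 ih'
  · by_cases h12 : k 1 = 0 ∧ k 2 = 0
    · obtain ⟨a, rfl⟩ : ∃ a, k = ![a, 0, 0] := ⟨k 0, by ext i; fin_cases i <;> simp [h12.1, h12.2]⟩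
      exact pin_axis₀ Q hsymm hrow hcol hpol a hk (by simpa [vec3_dotProduct] using h4)
        fun k' hk' hlt => ih' k' hk' (by simpa [vec3_dotProduct] using hlt)
    · exact pin_peel₀ Q hsymm hrow hcol hpol hk h0 (by tauto) h4 ih'

end Summit.AnomalousDissipation.AnomalousDissipation.Theorems.MomentParityQuarticGate.AxialQuad

namespace Summit.AnomalousDissipation.AnomalousDissipation.Theorems.MomentParityQuarticGate

-- the summit-side namespace repeats `AnomalousDissipation` by the tree's convention
set_option linter.dupNamespace false in
/-- **Registered sub-goal `axialQuad_centre` of stub S2q** (summary of this file): CENTRE RIGIDITY — every wavevector of the punctured ball is pinned to one `(α, β)`. [folklore] -/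
theorem axialQuad_centre : ∀ (Q : ((Fin 3 → ℤ) → (Fin 3 → ℤ) → Matrix (Fin 3) (Fin 3) ℂ)) (N : ℕ), 2 ≤ N → (∀ a b : Fin 3 → ℤ, Q b a = Matrix.transpose (Q a b)) → (∀ a b : Fin 3 → ℤ, Matrix.vecMul (fun i : Fin 3 => (((a : Fin 3 → ℤ) i : ℤ) : ℂ)) (Q a b) = 0) → (∀ a b : Fin 3 → ℤ, Matrix.mulVec (Q a b) (fun i : Fin 3 => (((b : Fin 3 → ℤ) i : ℤ) : ℂ)) = 0) → (∀ (k₁ k₂ k₃ : Fin 3 → ℤ) (v₁ v₂ v₃ : Fin 3 → ℂ), ((k₁ : Fin 3 → ℤ) ≠ 0 ∧ (k₁) ⬝ᵥ (k₁) ≤ ((N : ℕ) : ℤ) ^ 2) → ((k₂ : Fin 3 → ℤ) ≠ 0 ∧ (k₂) ⬝ᵥ (k₂) ≤ ((N : ℕ) : ℤ) ^ 2) → ((k₃ : Fin 3 → ℤ) ≠ 0 ∧ (k₃) ⬝ᵥ (k₃) ≤ ((N : ℕ) : ℤ) ^ 2) → v₁ ⬝ᵥ (fun i : Fin 3 =>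 (((k₁ : Fin 3 → ℤ) i : ℤ) : ℂ)) = 0 → v₂ ⬝ᵥ (fun i : Fin 3 => (((k₂ : Fin 3 → ℤ) i : ℤ) : ℂ)) = 0 → v₃ ⬝ᵥ (fun i : Fin 3 => (((k₃ : Fin 3 → ℤ) i : ℤ) : ℂ)) = 0 → (((v₁) ⬝ᵥ (fun i : Fin 3 => (((k₂ : Fin 3 → ℤ) i : ℤ) : ℂ))) • (v₂) + ((v₂) ⬝ᵥ (fun i : Fin 3 => (((k₁ : Fin 3 → ℤ) i : ℤ) : ℂ))) • (v₁) : Fin 3 → ℂ) ⬝ᵥ (Matrix.mulVec (Q (k₁ + k₂) k₃) v₃) + (((v₁) ⬝ᵥ (fun i : Fin 3 => (((k₃ : Fin 3 → ℤ) i : ℤ) : ℂ))) • (v₃) + ((v₃) ⬝ᵥ (fun i : Fin 3 => (((k₁ : Fin 3 → ℤ) i : ℤ) : ℂ))) • (v₁) : Fin 3 → ℂ) ⬝ᵥ (Matrix.mulVec (Q (k₁ + k₃) k₂) v₂) + (((v₂) ⬝ᵥ (fun i : Fin 3 => (((k₃ : Fin 3 → ℤ) i : ℤ) : ℂ))) •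 (v₃) + ((v₃) ⬝ᵥ (fun i : Fin 3 => (((k₂ : Fin 3 → ℤ) i : ℤ) : ℂ))) • (v₂) : Fin 3 → ℂ) ⬝ᵥ (Matrix.mulVec (Q (k₂ + k₃) k₁) v₁) = 0) → ∀ (k : Fin 3 → ℤ), ((k : Fin 3 → ℤ) ≠ 0 ∧ (k) ⬝ᵥ (k) ≤ ((N : ℕ) : ℤ) ^ 2) → (∀ y : Fin 3 → ℂ, y ⬝ᵥ (fun i : Fin 3 => (((k : Fin 3 → ℤ) i : ℤ) : ℂ)) = 0 → Matrix.mulVec (Q (-(k)) (k)) y = (Q ![-1, 0, 0] ![1, 0, 0] 1 1) • y + (Q ![-1, 0, 0] ![1, 0, 0] 2 1) • (crossProduct (fun i : Fin 3 => (((k : Fin 3 → ℤ) i : ℤ) : ℂ)) y)) :=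
  fun Q _ hN hsymm hrow hcol hpol k hk => AxialQuad.centre_pinned Q hN hsymm hrow hcol hpol k hk

end Summit.AnomalousDissipation.AnomalousDissipation.Theorems.MomentParityQuarticGate
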